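import Summits.CriticalPhenomena.PercolationContinuityZ3.Theorems.PercNearOneGluingNoHeavyLowerTailThreePointCPIClusterSwapDefs
import HarnessLib

/-!
# The cluster flip `μ_t`: an involution swapping "closed-joined to `s`" with "open-joined to `s` avoiding `Q_b`"

Crux `stmt-CriticalPhenomena-4575`, route `PercNearOneGluingNoHeavy`, 3-point CPI₂ fibre line (facecert gen 28; memo
`prim-l12/prim-facecert/FINDING-gen28-CLUSTER-SWAP.md`; definitions in `…ThreePointCPIClusterSwapDefs`).
Notation (one configuration `z : α → Bool` of a finite multigraph `(V, α, ends)`, terminals `s, b`, port `c`):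
`Q_t(z)` = closed cluster of `t` (`CReach`), `μ_t` = the cluster flip (`clusterFlip`: complement every label with no
endpoint in `V(Q_t(z))`), `U_s(z)` = open reach of `s` avoiding `V(Q_b(z))` (`UReach ends s b z`), `D = {s ↮ b closed}`,
`J = {s ↔ b open}`, `Y = {c ↔ {s,b} open}`, `A₃ = #{¬J ∧ Y}`, `B₃ = #{¬J(z) ∧ Y(z̄)} = #{D ∧ Y}`.

* `creach_clusterFlip_iff`, `clusterFlip_clusterFlip` — `μ_t` preserves `Q_t` and is an INVOLUTION of `{0,1}^α`.
* `ureach_clusterFlip_iff`, `creach_clusterFlip_iff_ureach` — **THE SWAP**: if `s ∉ Q_b(z)` (i.e. `z ∈ D`) then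
  `U_s(μ_b z) = V(Q_s(z))` and `V(Q_s(μ_b z)) = U_s(z)`; `μ_b` preserves `D`.
* `reachable_of_ureach`, `not_creach_of_ureach` — `U_s ⊆ C_s` and `U_s ∩ V(Q_b) = ∅`.

The counting consequences (`#{D, c∈Q_s} = #{D, c∈U_s}`, the exact form `A₃ = #{D, c∈U_s} + #{D, c∈U_b}` of Reimer's
inequality for `(Y, D)`, and the reformulation of the 3-point CPI₂ as a "pocket bound" inside `D`) are in
`…ThreePointCPIClusterSwapCount`.
-/

namespace Summit.CriticalPhenomena.PercolationContinuityZ3.Theorems.ThreePointCPIClusterSwap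

open Finset Literature.Probability.Percolation

variable {V α : Type*}

/-! ### The closed cluster and the cluster flip -/

section Basic

variable (ends : α → Sym2 V) (t : V)

/-- `t` lies in its own closed cluster. [this work] -/
theorem creach_self (z : α → Bool) : CReach ends z t t := SimpleGraph.Reachable.refl _

/-- **Growth step.** A closed label at a vertex of `Q_t(z)` extends `Q_t(z)`. [this work] -/
theorem creach_step (z : α → Bool) {a : α} {u w : V} (ha : z a = false) (hends : ends a = s(u, w))
    (hu : CReach ends z t u) : CReach ends z t w := by
  by_cases huw : u = w
  · exact huw ▸ hu
  refine hu.trans (SimpleGraph.Adj.reachable ?_)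
  rw [openGraph_adj]
  exact ⟨⟨a, by show (!z a) = true; rw [ha]; rfl, hends⟩, huw⟩

/-- A closed label with one endpoint in `Q_t(z)` touches `Q_t(z)` with both endpoints. [this work] -/
theorem creach_of_mem (z : α → Bool) {a : α} {u w : V} (ha : z a = false) (hends : ends a = s(u, w))
    (h : QTouch ends t z a) : CReach ends z t u ∧ CReach ends z t w := by
  obtain ⟨v, hv, hRv⟩ := h
  rw [hends, Sym2.mem_iff] at hv
  rcases hv with rfl | rfl
  · exact ⟨hRv, creach_step ends t z ha hends hRv⟩
  · exact ⟨creach_step ends t z ha (hends.trans Sym2.eq_swap) hRv, hRv⟩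

open Classical in
/-- The cluster flip keeps every label touching the closed cluster. [this work] -/
theorem clusterFlip_of_qtouch (z : α → Bool) {a : α} (h : QTouch ends t z a) :
    clusterFlip ends t z a = z a := by
  simp only [clusterFlip, if_pos h]

open Classical in
/-- The cluster flip complements every label not touching the closed cluster. [this work] -/
theorem clusterFlip_of_not_qtouch (z : α → Bool) {a : α} (h : ¬ QTouch ends t z a) :
    clusterFlip ends t z a = !z a := by
  simp only [clusterFlip, if_neg h]

/-- **Transfer of closed walks.** If every `x₁`-closed label touching `Q_t(z)` is `z`-closed and `x₂`-closed, then a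
closed walk of `x₁` starting in `V(Q_t(z))` stays in `V(Q_t(z))` and is a closed walk of `x₂`. [this work] -/
theorem creach_transfer (z x₁ x₂ : α → Bool)
    (H : ∀ a, x₁ a = false → QTouch ends t z a → z a = false ∧ x₂ a = false)
    {u v : V} (p : (openGraph (labelledOpen ends fun a => !x₁ a)).Walk u v) (hu : CReach ends z t u) :
    CReach ends z t v ∧ (openGraph (labelledOpen ends fun a => !x₂ a)).Reachable u v := by
  induction p with
  | nil => exact ⟨hu, SimpleGraph.Reachable.refl _⟩
  | @cons u x v hadj p ih =>
    rw [openGraph_adj] at hadj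
    obtain ⟨⟨a, ha, hends⟩, hux⟩ := hadj
    have ha' : x₁ a = false := by simpa using ha
    have htouch : QTouch ends t z a := ⟨u, by rw [hends]; exact Sym2.mem_mk_left _ _, hu⟩
    obtain ⟨hza, hx₂a⟩ := H a ha' htouch
    have hx : CReach ends z t x := creach_step ends t z hza hends hu
    obtain ⟨hv, hreach⟩ := ih hx
    refine ⟨hv, SimpleGraph.Reachable.trans (SimpleGraph.Adj.reachable ?_) hreach⟩
    rw [openGraph_adj]
    exact ⟨⟨a, by show (!x₂ a) = true; rw [hx₂a]; rfl, hends⟩, hux⟩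

/-- **The cluster flip preserves the closed cluster.** [this work] -/
theorem creach_clusterFlip_iff (z : α → Bool) (v : V) :
    CReach ends (clusterFlip ends t z) t v ↔ CReach ends z t v := by
  constructor
  · rintro ⟨p⟩
    refine (creach_transfer ends t z (clusterFlip ends t z) z ?_ p (creach_self ends t z)).1
    intro a ha ht
    rw [clusterFlip_of_qtouch ends t z ht] at ha
    exact ⟨ha, ha⟩
  · rintro ⟨p⟩
    refine (creach_transfer ends t z z (clusterFlip ends t z) ?_ p (creach_self ends t z)).2
    intro a ha ht
    exact ⟨ha, by rw [clusterFlip_of_qtouch ends t z ht]; exact ha⟩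

/-- The cluster flip preserves the set of labels touching the closed cluster. [this work] -/
theorem qtouch_clusterFlip_iff (z : α → Bool) (a : α) :
    QTouch ends t (clusterFlip ends t z) a ↔ QTouch ends t z a := by
  simp only [QTouch, creach_clusterFlip_iff ends t z]

/-- **`μ_t` is an involution.** [this work] -/
theorem clusterFlip_clusterFlip (z : α → Bool) :
    clusterFlip ends t (clusterFlip ends t z) = z := by
  funext a
  by_cases h : QTouch ends t z a
  · rw [clusterFlip_of_qtouch ends t _ ((qtouch_clusterFlip_iff ends t z a).2 h),
      clusterFlip_of_qtouch ends t z h]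
  · rw [clusterFlip_of_not_qtouch ends t _ (fun h' => h ((qtouch_clusterFlip_iff ends t z a).1 h')),
      clusterFlip_of_not_qtouch ends t z h, Bool.not_not]

end Basic

/-! ### The swap: `U_s(μ_b z) = V(Q_s(z))` and `V(Q_s(μ_b z)) = U_s(z)` -/

section Swap

variable (ends : α → Sym2 V) (s b : V)

/-- Inside `D` the two closed clusters are disjoint: a vertex of `Q_s(z)` is not in `Q_b(z)`. [this work] -/
theorem not_creach_of_creach (z : α → Bool) (hD : ¬ CReach ends z b s) {v : V} (hv : CReach ends z s v) :
    ¬ CReach ends z b v :=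
  fun h => hD (h.trans hv.symm)

/-- **Swap, first half.** If `s ∉ Q_b(z)` then a vertex is open-joined to `s` avoiding `V(Q_b)` in `μ_b(z)` iff it is
closed-joined to `s` in `z`:  `U_s(μ_b z) = V(Q_s(z))`. [this work] -/
theorem ureach_clusterFlip_iff (z : α → Bool) (hD : ¬ CReach ends z b s) (v : V) :
    UReach ends s b (clusterFlip ends b z) v ↔ CReach ends z s v := by
  constructor
  · -- an open path of μ_b z avoiding V(Q_b(μ_b z)) = V(Q_b(z)) uses complemented labels: it is z-closed
    have key : ∀ {x w : V} (q : (openGraph (avoidQ ends b (clusterFlip ends b z))).Walk x w),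
        CReach ends z s x → CReach ends z s w := by
      intro x w q
      induction q with
      | nil => exact id
      | @cons x y w hadj q ih =>
        intro hx
        rw [openGraph_adj] at hadj
        obtain ⟨⟨⟨a, ha, hends⟩, havoid⟩, _⟩ := hadj
        have hnt : ¬ QTouch ends b z a := by
          rintro ⟨y', hy', hRy'⟩
          exact havoid y' (hends ▸ hy') ((creach_clusterFlip_iff ends b z y').2 hRy')
        rw [clusterFlip_of_not_qtouch ends b z hnt] at ha
        have hza : z a = false := by simpa using ha
        exact ih (creach_step ends s z hza hends hx)
    rintro ⟨p⟩
    exact key p (creach_self ends s z)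
  · -- a closed path of z from s: its labels have both endpoints in Q_s(z), hence none in Q_b(z); they are complemented
    rintro ⟨p⟩
    have key : ∀ {u v : V} (q : (openGraph (labelledOpen ends fun a => !z a)).Walk u v), CReach ends z s u →
        (openGraph (avoidQ ends b (clusterFlip ends b z))).Reachable u v := by
      intro u v q
      induction q with
      | nil => exact fun _ => SimpleGraph.Reachable.refl _
      | @cons u x v hadj q ih =>
        intro hu
        rw [openGraph_adj] at hadj
        obtain ⟨⟨a, ha, hends⟩, hux⟩ := hadj
        have hza : z a = false := by simpa using ha
        have hx : CReach ends z s x := creach_step ends s z hza hends hu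
        have hnt : ¬ QTouch ends b z a := by
          rintro ⟨y, hy, hRy⟩
          rw [hends, Sym2.mem_iff] at hy
          rcases hy with rfl | rfl
          · exact not_creach_of_creach ends s b z hD hu hRy
          · exact not_creach_of_creach ends s b z hD hx hRy
        have hμa : clusterFlip ends b z a = true := by
          rw [clusterFlip_of_not_qtouch ends b z hnt, hza]; rfl
        refine SimpleGraph.Reachable.trans (SimpleGraph.Adj.reachable ?_) (ih hx)
        rw [openGraph_adj]
        refine ⟨⟨⟨a, hμa, hends⟩, ?_⟩, hux⟩
        intro y hy hRy
        rw [creach_clusterFlip_iff ends b z y] at hRy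
        rw [Sym2.mem_iff] at hy
        rcases hy with rfl | rfl
        · exact not_creach_of_creach ends s b z hD hu hRy
        · exact not_creach_of_creach ends s b z hD hx hRy
    exact key p (creach_self ends s z)

/-- The cluster flip `μ_b` preserves `D = {s ∉ Q_b}`. [this work] -/
theorem not_creach_clusterFlip_iff (z : α → Bool) :
    ¬ CReach ends (clusterFlip ends b z) b s ↔ ¬ CReach ends z b s := by
  rw [creach_clusterFlip_iff ends b z s]

/-- **Swap, second half.** If `s ∉ Q_b(z)` then `V(Q_s(μ_b z)) = U_s(z)`. [this work] -/
theorem creach_clusterFlip_iff_ureach (z : α → Bool) (hD : ¬ CReach ends z b s) (v : V) :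
    CReach ends (clusterFlip ends b z) s v ↔ UReach ends s b z v := by
  have hD' : ¬ CReach ends (clusterFlip ends b z) b s := (not_creach_clusterFlip_iff ends s b z).2 hD
  have h := ureach_clusterFlip_iff ends s b (clusterFlip ends b z) hD' v
  rw [clusterFlip_clusterFlip ends b z] at h
  exact h.symm

/-- A vertex open-joined to `s` avoiding `V(Q_b(z))` is open-joined to `s`. [this work] -/
theorem reachable_of_ureach (z : α → Bool) {v : V} (h : UReach ends s b z v) :
    (openGraph (labelledOpen ends z)).Reachable s v := by
  obtain ⟨p⟩ := h
  refine ⟨p.transfer (openGraph (labelledOpen ends z)) fun e he => ?_⟩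
  have heG := p.edges_subset_edgeSet he
  rw [openGraph, SimpleGraph.edgeSet_fromEdgeSet] at heG ⊢
  exact ⟨heG.1.1, heG.2⟩

/-- A vertex open-joined to `s` avoiding `V(Q_b(z))` is not in `Q_b(z)` (given `s ∉ Q_b(z)`). [this work] -/
theorem not_creach_of_ureach (z : α → Bool) (hD : ¬ CReach ends z b s) {v : V} (h : UReach ends s b z v) :
    ¬ CReach ends z b v := by
  obtain ⟨p⟩ := h
  cases hp : p.reverse with
  | nil => exact hD
  | cons hadj _ =>
    rw [openGraph_adj] at hadj
    obtain ⟨⟨_, havoid⟩, _⟩ := hadj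
    exact havoid v (Sym2.mem_mk_left _ _)

end Swap


end Summit.CriticalPhenomena.PercolationContinuityZ3.Theorems.ThreePointCPIClusterSwap
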